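import Summits.QuantumFields.YangMills.Theorems.SwapVirialDeficitSigmaBallModel
import HarnessLib

/-!
# END-CORE LEADER-SIDE INTEGRALS, brick (U1): the `u`-FIRST plane integral WITH the gnomonic weight — `∫_{ℝ²}(A+|u|²)^{-2}e^{−κ|u|²/(A+|u|²)} ≤ π²/(Aκ)`
# (stub `stub_core_end` of skeleton ➎, leader side; LEAD sfw-p2 g99 memo8 §2 / memo10 §2 «integrate the transverse letter u FIRST», answer 21:56Z (a);
# free-hands support of ⟨stmt-QuantumFields-24197⟩ `SwapVirialDeficit.SwapGluedStiffness`)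

In the end core the transverse `x`-letter `u ∈ ℝ²` carries the product floor `|u|²·B/(P(L)(1+|x|²)(1+δ²))` (✓`gnoDeficit_hubAt_ge_sigma_product`) against the gnomonic
weight `(1+|x|²)^{-2} = (A + |u|²)^{-2}`, `A = 1 + x₀²`.  With a `u`-free minorant `κ` of the rate this file bounds the whole-plane `u`-integral by ONE rational majorant
(no near/far split): `e^{−s} ≤ 2/(1+s)²` (`exp_neg_le_two_div_one_add_sq`) gives `(A+t)^{-2}e^{−κt/(A+t)} ≤ 2/(A+(1+κ)t)²` (`weight_mul_exp_le`), AM–GM splits the plane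
weight into a product of two Cauchy densities (`inv_sq_le_quarter_mul_inv`), and `∫dx/(a+kx²) = π/√(ak)` (`integral_inv_add_mul_sq`, `lintegral_inv_add_mul_sq`) twice:
* ★★ `lintegral_uFirst_le (hA : 0 < A) (hκ : 0 < κ) : ∫⁻ u : ℝ × ℝ, ofReal((A + |u|²)^{-2}·e^{−κ|u|²/(A+|u|²)}) ≤ ofReal(π²/(A·κ))` — the A-side density `1/κ` times the
  E1 weight `1/A = (1+x₀²)⁻¹`, exactly the shape the Σ-slab integral (✓`lintegral_octant_slab_inv_sum_sq_le`) then consumes.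
Companion of LEAD's ✓`lintegral_exp_neg_mul_sq_norm_two[_le]` (pure Gaussian, no weight).  NOTE for the assembler: inside the end core `|u|² ≤ 1 + x₀²` always
(`|u| < τ ≤ 1` off the tube, `x₀² > 1 + |u|²` on the cap complement), so on the core the rate may be taken `κ = c·B₀(δ,x₀,y₀)` with LEAD's `u`-free
`B₀ = 16δ²/(1+δ²) + 8x₀²/((1+x₀²)(1+δ²)) + 4y₀²/(1+y₀²)` (21:56Z).

HONEST LABEL: elementary real analysis (Mathlib only); `stub_core_end`, stubs B (assembly) ∕ core-tip ∕ 001-good, ⟨24197⟩ ∕ ⟨24194⟩ and every rung OPEN; own crux ⟨22884⟩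
OPEN (blocked-on ⟨19935⟩); the Yang–Mills mass gap is NOT proved; no summit is proved by a line.  THEOREMS ONLY (0 `def`, 0 `sorry`), standard axioms.
Width seat ym-line-sfw-p2-w3 g67 (cell ym-idea-1, free hands), `--supports stmt-QuantumFields-24197`.  References: [folklore].
-/

set_option autoImplicit false

noncomputable section

open MeasureTheory Set Real
open scoped ENNReal

namespace Summit.QuantumFields.YangMills.Theorems.SwapVirialDeficit.SigmaBall

/-- `e^{−s} ≤ 2/(1+s)²` for `s ≥ 0` (from `e^s ≥ 1 + s + s²/2 ≥ (1+s)²/2`). [folklore] -/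
theorem exp_neg_le_two_div_one_add_sq {s : ℝ} (hs : 0 ≤ s) : Real.exp (-s) ≤ 2 / (1 + s) ^ 2 := by
  have h1 : 1 + s + s ^ 2 / 2 ≤ Real.exp s := by
    have := Real.quadratic_le_exp_of_nonneg hs
    linarith
  have h2 : (1 + s) ^ 2 / 2 ≤ Real.exp s := by nlinarith [h1]
  have hpos : 0 < (1 + s) ^ 2 := by positivity
  rw [Real.exp_neg, inv_eq_one_div, div_le_div_iff₀ (Real.exp_pos s) hpos]
  nlinarith [h2]

/-- ★ **The pointwise `u`-first majorant**: for `A > 0`, `κ ≥ 0`, `t ≥ 0`: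
`(A + t)^{-2}·exp(−κ·t/(A + t)) ≤ 2/(A + (1 + κ)·t)²` — the gnomonic weight times the product-floor Boltzmann factor is dominated by ONE rational function whose
plane integral is `2π/(A(1+κ)) ≤ 2π/(A·κ)`. [folklore] -/
theorem weight_mul_exp_le {A κ t : ℝ} (hA : 0 < A) (hκ : 0 ≤ κ) (ht : 0 ≤ t) :
    ((A + t) ^ 2)⁻¹ * Real.exp (-(κ * t / (A + t))) ≤ 2 / (A + (1 + κ) * t) ^ 2 := by
  have hAt : 0 < A + t := by linarith
  have hs : 0 ≤ κ * t / (A + t) := by positivity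
  have h1 := exp_neg_le_two_div_one_add_sq hs
  have e : (A + t) * (1 + κ * t / (A + t)) = A + (1 + κ) * t := by field_simp; ring
  calc ((A + t) ^ 2)⁻¹ * Real.exp (-(κ * t / (A + t))) ≤ ((A + t) ^ 2)⁻¹ * (2 / (1 + κ * t / (A + t)) ^ 2) :=
        mul_le_mul_of_nonneg_left h1 (by positivity)
    _ = 2 / ((A + t) * (1 + κ * t / (A + t))) ^ 2 := by rw [mul_pow]; field_simp
    _ = 2 / (A + (1 + κ) * t) ^ 2 := by rw [e]

/-- The product split of the plane weight: `(A + k(p+q))^{-2} ≤ ¼·(A/2 + kp)⁻¹·(A/2 + kq)⁻¹` for `A > 0`, `k, p, q ≥ 0` (AM–GM). [folklore] -/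
theorem inv_sq_le_quarter_mul_inv {A k p q : ℝ} (hA : 0 < A) (hk : 0 ≤ k) (hp : 0 ≤ p) (hq : 0 ≤ q) :
    ((A + k * (p + q)) ^ 2)⁻¹ ≤ (1 / 4) * ((A / 2 + k * p)⁻¹ * (A / 2 + k * q)⁻¹) := by
  have h1 : 0 < A / 2 + k * p := by positivity
  have h2 : 0 < A / 2 + k * q := by positivity
  have e : A + k * (p + q) = (A / 2 + k * p) + (A / 2 + k * q) := by ring
  rw [e]
  have h4 : 4 * ((A / 2 + k * p) * (A / 2 + k * q)) ≤ ((A / 2 + k * p) + (A / 2 + k * q)) ^ 2 := by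
    nlinarith [sq_nonneg ((A / 2 + k * p) - (A / 2 + k * q))]
  rw [show (1 / 4 : ℝ) * ((A / 2 + k * p)⁻¹ * (A / 2 + k * q)⁻¹) = (4 * ((A / 2 + k * p) * (A / 2 + k * q)))⁻¹ by
    rw [mul_inv, mul_inv]; ring]
  exact inv_anti₀ (by positivity) h4

/-! ## The integrals -/

/-- `∫ dx/(a + k x²) = π/√(a k)` (`a, k > 0`). [folklore] -/
theorem integral_inv_add_mul_sq {a k : ℝ} (ha : 0 < a) (hk : 0 < k) : ∫ x : ℝ, (a + k * x ^ 2)⁻¹ = π / Real.sqrt (a * k) := by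
  set c : ℝ := Real.sqrt (k / a) with hc
  have hcpos : 0 < c := Real.sqrt_pos.2 (div_pos hk ha)
  have hc2 : c ^ 2 = k / a := Real.sq_sqrt (div_pos hk ha).le
  have e : (fun x : ℝ => (a + k * x ^ 2)⁻¹) = fun x => a⁻¹ * (1 + (c * x) ^ 2)⁻¹ := by
    funext x
    have h1 : a + k * x ^ 2 = a * (1 + (c * x) ^ 2) := by
      rw [mul_pow, hc2]; field_simp
    rw [h1, mul_inv]
  rw [e, integral_const_mul, Measure.integral_comp_mul_left (fun y : ℝ => (1 + y ^ 2)⁻¹) c, integral_univ_inv_one_add_sq, smul_eq_mul,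
    abs_of_pos (inv_pos.2 hcpos)]
  have hsq : (a * c) ^ 2 = a * k := by rw [mul_pow, hc2]; field_simp
  have hak : Real.sqrt (a * k) = a * c := by rw [← hsq, Real.sqrt_sq (by positivity)]
  rw [hak]; field_simp

/-- The integrand `(a + k x²)⁻¹` is integrable. [folklore] -/
theorem integrable_inv_add_mul_sq {a k : ℝ} (ha : 0 < a) (hk : 0 < k) : Integrable fun x : ℝ => (a + k * x ^ 2)⁻¹ := by
  refine Integrable.of_integral_ne_zero ?_
  rw [integral_inv_add_mul_sq ha hk]
  have : 0 < Real.sqrt (a * k) := Real.sqrt_pos.2 (mul_pos ha hk)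
  positivity

/-- The `ℝ≥0∞` form: `∫⁻ ofReal((a + k x²)⁻¹) = ofReal(π/√(ak))`. [folklore] -/
theorem lintegral_inv_add_mul_sq {a k : ℝ} (ha : 0 < a) (hk : 0 < k) :
    ∫⁻ x : ℝ, ENNReal.ofReal ((a + k * x ^ 2)⁻¹) = ENNReal.ofReal (π / Real.sqrt (a * k)) := by
  rw [← integral_inv_add_mul_sq ha hk, ofReal_integral_eq_lintegral_ofReal (integrable_inv_add_mul_sq ha hk)
    (Filter.Eventually.of_forall fun x => by positivity)]

/-- ★★ **THE `u`-FIRST INTEGRAL WITH THE GNOMONIC WEIGHT** (plane letters `u = (u₁, u₂)`, `A = 1 + x₀² > 0`, rate `κ > 0`):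
`∫⁻_{ℝ²} (A + |u|²)^{-2}·e^{−κ|u|²/(A + |u|²)} ≤ π²/(A·κ)` — memo8 §2 «integrate the transverse letter FIRST»: the product-floor Boltzmann factor against the
gnomonic `x`-weight yields the A-side density `1/κ` times the E1 weight `1/A`, with NO split of the `u`-plane. [folklore] -/
theorem lintegral_uFirst_le {A κ : ℝ} (hA : 0 < A) (hκ : 0 < κ) :
    ∫⁻ u : ℝ × ℝ, ENNReal.ofReal (((A + (u.1 ^ 2 + u.2 ^ 2)) ^ 2)⁻¹ * Real.exp (-(κ * (u.1 ^ 2 + u.2 ^ 2) / (A + (u.1 ^ 2 + u.2 ^ 2))))) ≤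
      ENNReal.ofReal (π ^ 2 / (A * κ)) := by
  set k : ℝ := 1 + κ with hk
  have hkpos : 0 < k := by rw [hk]; linarith
  have ha2 : 0 < A / 2 := by linarith
  -- pointwise majorant by a product
  have hpt : ∀ u : ℝ × ℝ, ENNReal.ofReal (((A + (u.1 ^ 2 + u.2 ^ 2)) ^ 2)⁻¹ * Real.exp (-(κ * (u.1 ^ 2 + u.2 ^ 2) / (A + (u.1 ^ 2 + u.2 ^ 2))))) ≤
      ENNReal.ofReal ((A / 2 + k * u.1 ^ 2)⁻¹) * ENNReal.ofReal ((1 / 2) * (A / 2 + k * u.2 ^ 2)⁻¹) := by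
    intro u
    rw [← ENNReal.ofReal_mul (by positivity)]
    refine ENNReal.ofReal_le_ofReal ?_
    have h1 := weight_mul_exp_le hA hκ.le (show 0 ≤ u.1 ^ 2 + u.2 ^ 2 by positivity)
    have h2 := inv_sq_le_quarter_mul_inv hA hkpos.le (sq_nonneg u.1) (sq_nonneg u.2)
    rw [← hk] at h1
    have h3 : 2 / (A + k * (u.1 ^ 2 + u.2 ^ 2)) ^ 2 = 2 * ((A + k * (u.1 ^ 2 + u.2 ^ 2)) ^ 2)⁻¹ := by rw [div_eq_mul_inv]
    rw [h3] at h1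
    calc ((A + (u.1 ^ 2 + u.2 ^ 2)) ^ 2)⁻¹ * Real.exp (-(κ * (u.1 ^ 2 + u.2 ^ 2) / (A + (u.1 ^ 2 + u.2 ^ 2)))) ≤ 2 * ((A + k * (u.1 ^ 2 + u.2 ^ 2)) ^ 2)⁻¹ := h1
      _ ≤ 2 * ((1 / 4) * ((A / 2 + k * u.1 ^ 2)⁻¹ * (A / 2 + k * u.2 ^ 2)⁻¹)) := by linarith [h2]
      _ = (A / 2 + k * u.1 ^ 2)⁻¹ * ((1 / 2) * (A / 2 + k * u.2 ^ 2)⁻¹) := by ring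
  refine (lintegral_mono hpt).trans ?_
  have hf : AEMeasurable (fun x : ℝ => ENNReal.ofReal ((A / 2 + k * x ^ 2)⁻¹)) volume := (Measurable.ennreal_ofReal (by fun_prop)).aemeasurable
  have hg : AEMeasurable (fun y : ℝ => ENNReal.ofReal ((1 / 2) * (A / 2 + k * y ^ 2)⁻¹)) volume := (Measurable.ennreal_ofReal (by fun_prop)).aemeasurable
  have hprod : ∫⁻ u : ℝ × ℝ, ENNReal.ofReal ((A / 2 + k * u.1 ^ 2)⁻¹) * ENNReal.ofReal ((1 / 2) * (A / 2 + k * u.2 ^ 2)⁻¹) ∂((volume : Measure ℝ).prod volume) =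
      (∫⁻ x : ℝ, ENNReal.ofReal ((A / 2 + k * x ^ 2)⁻¹)) * ∫⁻ y : ℝ, ENNReal.ofReal ((1 / 2) * (A / 2 + k * y ^ 2)⁻¹) :=
    lintegral_prod_mul hf hg
  rw [Measure.volume_eq_prod, hprod, lintegral_inv_add_mul_sq ha2 hkpos]
  have e2 : ∫⁻ y : ℝ, ENNReal.ofReal ((1 / 2) * (A / 2 + k * y ^ 2)⁻¹) = ENNReal.ofReal ((1 / 2) * (π / Real.sqrt (A / 2 * k))) := by
    have : (fun y : ℝ => ENNReal.ofReal ((1 / 2) * (A / 2 + k * y ^ 2)⁻¹)) = fun y => ENNReal.ofReal (1 / 2) * ENNReal.ofReal ((A / 2 + k * y ^ 2)⁻¹) := by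
      funext y; rw [← ENNReal.ofReal_mul (by norm_num)]
    rw [this, lintegral_const_mul _ (Measurable.ennreal_ofReal (by fun_prop)), lintegral_inv_add_mul_sq ha2 hkpos, ← ENNReal.ofReal_mul (by norm_num)]
  rw [e2, ← ENNReal.ofReal_mul (by positivity)]
  refine ENNReal.ofReal_le_ofReal ?_
  have hx : Real.sqrt (A / 2 * k) ^ 2 = A / 2 * k := Real.sq_sqrt (by positivity)
  have e3 : π / Real.sqrt (A / 2 * k) * (1 / 2 * (π / Real.sqrt (A / 2 * k))) = π ^ 2 / (A * k) := by
    rw [show π / Real.sqrt (A / 2 * k) * (1 / 2 * (π / Real.sqrt (A / 2 * k))) = π ^ 2 / (2 * Real.sqrt (A / 2 * k) ^ 2) by ring, hx]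
    ring
  rw [e3]
  exact div_le_div_of_nonneg_left (by positivity) (by positivity) (by nlinarith)

end Summit.QuantumFields.YangMills.Theorems.SwapVirialDeficit.SigmaBall

end
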